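import Mathlib
import Literature.NumberTheory.Transcendental.KZCalculus
import Literature.NumberTheory.Transcendental.SemialgebraicMapsProofs
import Summits.KontsevichZagierPeriods.KontsevichZagierPeriods.Theorems.TorsionLogsNeronTorsionSectorStubCornerChartLower
import Summits.KontsevichZagierPeriods.KontsevichZagierPeriods.Theorems.TorsionLogsNeronTorsionSectorStubCornerChartUpperAux
import Summits.KontsevichZagierPeriods.KontsevichZagierPeriods.Theorems.TorsionLogsNeronTorsionSectorStubLowerRegular
import Summits.KontsevichZagierPeriods.KontsevichZagierPeriods.Theorems.TorsionLogsNeronTorsionSectorStubGridDataAux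
import HarnessLib

/-!
# Crux `TorsionLogs.NeronTorsionSector` (stmt-KontsevichZagierPeriods-14500) — assembly, the corner chart (lower branch)

Helper for the lead's stub `stub_assembly` (line `registered`): discharge of the hypotheses of the landed
`stub_cornerChartLower` from the grid geometry and the landed `stub_lowerRegular`, and repackaging of its
conclusions in the form consumed by the chart steps (`stub_zeroStepInst`, `stub_cellStepZeroInst`,
`stub_chartTransportInst`) and the hard log `stub_logA`: the chart Haar density `R`, the chart translation `τ̂`,
the chart potentials `Q̂ = Qf∘(·)⁻²` and `Ĝ = G∘(·)⁻²` on `[0, s₁]`, `s₁ = x₁^{-1/2}`.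
[cite: KontsevichZagier2001, §1.2] [cite: SilvermanAEC2009, III.2.3]
-/

noncomputable section

open Set MeasureTheory Filter Topology
open Literature.NumberTheory.Transcendental Literature.ModelTheory.ExponentialFields

-- `Summit.KontsevichZagierPeriods.KontsevichZagierPeriods.…` is the tree's mandated layout (single-conjunct summit).
set_option linter.dupNamespace false

namespace Summit.KontsevichZagierPeriods.KontsevichZagierPeriods.Cruxes.NeronTorsionSector.Translation

/-- The radicand of the chart Haar density is positive on `[0, s₁]`: `4 − g₂s⁴ − g₃s⁶ = s⁶ f(s⁻²)` for `s > 0`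
with `s⁻² ≥ x₁ > e₁`. [cite: SilvermanAEC2009, III.2.3] -/
theorem asmCorner_rad_pos {g₂ g₃ e₁ x₁ s₁ : ℝ} {f : ℝ → ℝ} (hf : ∀ x, f x = 4 * x ^ 3 - g₂ * x - g₃)
    (hfpos : ∀ x, e₁ < x → 0 < f x) (hx₁ : e₁ < x₁) (hx₁0 : 0 < x₁) (hs₁x : s₁ ^ 2 * x₁ = 1) :
    ∀ s ∈ Set.Icc (0:ℝ) s₁, 0 < 4 - g₂ * s ^ 4 - g₃ * s ^ 6 := by
  intro s hs
  rcases hs.1.eq_or_lt with rfl | hs0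
  · norm_num
  · have hx : x₁ ≤ (s ^ 2)⁻¹ := by
      rw [le_inv_comm₀ hx₁0 (by positivity)]
      calc s ^ 2 ≤ s₁ ^ 2 := pow_le_pow_left₀ hs.1 hs.2 2
        _ = x₁⁻¹ := eq_inv_of_mul_eq_one_left hs₁x
    have hfx := hfpos _ (hx₁.trans_le hx)
    rw [hf] at hfx
    have e : 4 - g₂ * s ^ 4 - g₃ * s ^ 6 = s ^ 6 * (4 * (s ^ 2)⁻¹ ^ 3 - g₂ * (s ^ 2)⁻¹ - g₃) := by
      field_simp
    rw [e]; positivity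

/-- **The corner chart, lower branch** (see the module docstring). [cite: KontsevichZagier2001, §1.2] -/
theorem asmCorner_lower :
    ∀ (g₂ g₃ e₁ x₁ y₁ x₂ y₂ L₁ xm1 s₁ : ℝ) (f yb sl τ Y3 Qf sl3 X33 Y33 Qf3 Pg G τ' : ℝ → ℝ),
    (∀ x, f x = 4 * x ^ 3 - g₂ * x - g₃) → f e₁ = 0 → 0 < e₁ → (∀ x, e₁ < x → 0 < f x) →
    e₁ < x₁ → y₁ ^ 2 = f x₁ → y₁ < 0 →
    L₁ = (12 * x₁ ^ 2 - g₂) / (2 * y₁) → x₂ = L₁ ^ 2 / 4 - 2 * x₁ → y₂ = -(y₁ + L₁ * (x₂ - x₁)) →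
    e₁ < x₂ → x₂ < x₁ → y₂ < 0 →
    IsAlgebraic ℚ g₂ → IsAlgebraic ℚ g₃ → IsAlgebraic ℚ x₁ → IsAlgebraic ℚ y₁ →
    0 < s₁ → s₁ ^ 2 * x₁ = 1 → IsAlgebraic ℚ s₁ →
    yb = (fun x => -Real.sqrt (f x)) →
    sl = (fun x => (4 * x ^ 2 + 4 * x * x₁ + 4 * x₁ ^ 2 - g₂) / (yb x + y₁)) →
    τ = (fun x => sl x ^ 2 / 4 - x - x₁) →
    Y3 = (fun x => -(yb x + sl x * (τ x - x))) →
    Qf = (fun x => sl x / 2 + Y3 x / (2 * τ x) - yb x / (2 * x)) →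
    sl3 = (fun x => (4 * τ x ^ 2 + 4 * τ x * x₁ + 4 * x₁ ^ 2 - g₂) / (Y3 x + y₁)) →
    X33 = (fun x => sl3 x ^ 2 / 4 - τ x - x₁) →
    Y33 = (fun x => -(Y3 x + sl3 x * (X33 x - τ x))) →
    Qf3 = (fun x => sl3 x / 2 + Y33 x / (2 * X33 x) - Y3 x / (2 * τ x)) →
    Pg = (fun x => 4 * (x + 2 * x₁) * y₁ - L₁ * (4 * x ^ 2 + 4 * x * x₁ + 4 * x₁ ^ 2 - g₂)
      + 4 * (x + 2 * x₁) * yb x) →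
    G = (fun x => Pg x / (yb x + y₁) ^ 2 * Real.sqrt (x * X33 x) / τ x) →
    τ' = (fun x => Y3 x / yb x) →
    τ x₁ = x₂ → τ '' Set.Ioi x₁ = Set.Ioo x₂ x₁ →
    (∀ t, x₂ ≤ t → t < x₁ → e₁ < τ t ∧ τ t < x₁) →
    e₁ ≤ xm1 → xm1 < x₂ → (∀ t, xm1 < t → e₁ < τ t) →
    ∃ (R τh Qh Gs : ℝ → ℝ),
      (∀ s ∈ Set.Icc 0 s₁, 0 < 4 - g₂ * s ^ 4 - g₃ * s ^ 6) ∧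
      (∀ s, 0 < s → s ≤ s₁ →
        Real.sqrt (f (s ^ 2)⁻¹) = R s / s ^ 3 ∧ τh s = τ (s ^ 2)⁻¹ ∧ Qh s = Qf (s ^ 2)⁻¹ ∧ Gs s = G (s ^ 2)⁻¹ ∧
        x₁ ≤ (s ^ 2)⁻¹) ∧
      (∀ s ∈ Set.Icc 0 s₁, 0 < R s) ∧ ContinuousOn R (Set.Icc 0 s₁) ∧
      IsSemialgebraicFunOn ℚ {t : Fin 1 → ℝ | t 0 ∈ Set.Icc 0 s₁} (fun t => R (t 0)) ∧
      R 0 = 2 ∧ τh 0 = x₁ ∧ Qh 0 = y₁ / (2 * x₁) ∧ Gs 0 = -2 * Real.sqrt (τ x₁) / x₁ ∧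
      ContinuousOn τh (Set.Icc 0 s₁) ∧
      IsSemialgebraicFunOn ℚ {t : Fin 1 → ℝ | t 0 ∈ Set.Icc 0 s₁} (fun t => τh (t 0)) ∧
      Set.MapsTo τh (Set.Icc 0 s₁) (Set.Icc x₂ x₁) ∧ (∀ s ∈ Set.Ioo 0 s₁, τh s ∈ Set.Ioo x₂ x₁) ∧
      ContinuousOn Qh (Set.Icc 0 s₁) ∧
      IsSemialgebraicFunOn ℚ {t : Fin 1 → ℝ | t 0 ∈ Set.Icc 0 s₁} (fun t => Qh (t 0)) ∧
      ContinuousOn Gs (Set.Icc 0 s₁) ∧ (∀ s ∈ Set.Icc 0 s₁, Gs s ≠ 0) ∧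
      IsSemialgebraicFunOn ℚ {t : Fin 1 → ℝ | t 0 ∈ Set.Icc 0 s₁} (fun t => Gs (t 0)) ∧
      (∀ x, x₁ ≤ x → Y3 x < 0 ∧ Qf3 x = Qf (τ x) ∧ X33 x = τ (τ x) ∧ Y3 x = yb (τ x) ∧
        HasDerivAt τ (τ' x) x ∧ τ' x ≠ 0 ∧ |τ' x| * Real.sqrt (f x) = Real.sqrt (f (τ x)) ∧
        G x ≠ 0 ∧ HasDerivAt G (G x * ((Qf (τ x) - Qf x) / yb x)) x ∧ x₂ ≤ τ x ∧ τ x < x₁) := by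
  intro g₂ g₃ e₁ x₁ y₁ x₂ y₂ L₁ xm1 s₁ f yb sl τ Y3 Qf sl3 X33 Y33 Qf3 Pg G τ' hf he₁ he₁0 hfpos hx₁ hy₁ hy₁0
    hL₁ hx₂ hy₂ he₂ hx₂₁ hy₂0 ag₂ ag₃ ax₁ ay₁ hs₁ hs₁x as₁ hyb hsl hτ hY3 hQf hsl3 hX33 hY33 hQf3 hPg hG hτ'
    hτx₁ hτimg hτ12 hxm1 hxm1₂ hτpos
  have hx₁0 : 0 < x₁ := he₁0.trans hx₁
  have hx₂0 : 0 < x₂ := he₁0.trans he₂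
  -- the lower-branch package
  obtain ⟨L1, L2, L3, L4, L5, L6, L7⟩ := stub_lowerRegular g₂ g₃ e₁ x₁ y₁ x₂ y₂ L₁ xm1 f yb sl τ Y3 Qf sl3 X33
    Y33 Qf3 Pg G τ' hf he₁ he₁0 hfpos hx₁ hy₁ hy₁0 hL₁ hx₂ hy₂ he₂ hy₂0 ag₂ ag₃ ax₁ ay₁ hyb hsl hτ hY3 hQf hsl3
    hX33 hY33 hQf3 hPg hG hτ'
  have hxm1₁ : xm1 < x₁ := hxm1₂.trans hx₂₁
  have hY3neg : ∀ x, xm1 < x → Y3 x < 0 := L6 hxm1 hτpos hxm1₁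
  -- `τ` on `[x₁, ∞)`: values in `[x₂, x₁)`
  have hτrange : ∀ x, x₁ ≤ x → x₂ ≤ τ x ∧ τ x < x₁ := by
    intro x hx
    rcases hx.eq_or_lt with rfl | hlt
    · rw [hτx₁]; exact ⟨le_rfl, hx₂₁⟩
    · have : τ x ∈ Set.Ioo x₂ x₁ := by rw [← hτimg]; exact ⟨x, hlt, rfl⟩
      exact ⟨this.1.le, this.2⟩
  -- the point package on `[x₁, ∞)`
  have hpt : ∀ x, x₁ ≤ x → Y3 x < 0 ∧ Qf3 x = Qf (τ x) ∧ X33 x = τ (τ x) ∧ Y3 x = yb (τ x) ∧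
      HasDerivAt τ (τ' x) x ∧ τ' x ≠ 0 ∧ |τ' x| * Real.sqrt (f x) = Real.sqrt (f (τ x)) ∧
      G x ≠ 0 ∧ HasDerivAt G (G x * ((Qf (τ x) - Qf x) / yb x)) x ∧ x₂ ≤ τ x ∧ τ x < x₁ := by
    intro x hx
    have hex : e₁ < x := hx₁.trans_le hx
    obtain ⟨hτlo, hτhi⟩ := hτrange x hx
    have heτ : e₁ < τ x := he₂.trans_le hτlo
    have hy3 : Y3 x < 0 := hY3neg x (hxm1₁.trans_le hx)
    obtain ⟨hd, hd0, hhaar, _⟩ := L2 x hex heτ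
    obtain ⟨_, _, _, hG0, hGd⟩ := L3 x hex heτ hτhi
    obtain ⟨hq3, hx33, hy3'⟩ := L7 x hex heτ hy3
    refine ⟨hy3, hq3, hx33, hy3', hd, hd0, hhaar, hG0, ?_, hτlo, hτhi⟩
    rw [← hq3]; exact hGd
  -- the chart functions
  have hrad := asmCorner_rad_pos hf hfpos hx₁ hx₁0 hs₁x
  set R : ℝ → ℝ := fun s => Real.sqrt (4 - g₂ * s ^ 4 - g₃ * s ^ 6) with hR
  set Mh : ℝ → ℝ := fun s => 4 + 4 * x₁ * s ^ 2 + (4 * x₁ ^ 2 - g₂) * s ^ 4 with hMh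
  set Dl : ℝ → ℝ := fun s => R s - y₁ * s ^ 3 with hDl
  set Nt : ℝ → ℝ := fun s => 32 * x₁ + 4 * (12 * x₁ ^ 2 - g₂) * s ^ 2 + 8 * y₁ * s * R s
      + (16 * x₁ ^ 3 - 4 * g₂ * x₁ + 8 * g₃) * s ^ 4 + (4 * x₁ ^ 2 - g₂) ^ 2 * s ^ 6 with hNt
  set τh : ℝ → ℝ := fun s => Nt s / (4 * Dl s ^ 2) - x₁ with hτh
  set A₁ : ℝ → ℝ := fun s => -4 * x₁ - y₁ * s * R s - 4 * x₁ ^ 2 * s ^ 2 - g₃ * s ^ 4 with hA₁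
  set Qh : ℝ → ℝ := fun s => s * A₁ s / (2 * Dl s) - Real.sqrt (f (τh s)) / (2 * τh s) with hQh
  set Kh : ℝ → ℝ := fun s => -4 * R s - L₁ * s * Mh s - 8 * x₁ * s ^ 2 * R s + 4 * y₁ * s ^ 3
      + 8 * x₁ * y₁ * s ^ 5 with hKh
  set Gs : ℝ → ℝ := fun s => Kh s * Real.sqrt (τ (τh s)) / (Dl s ^ 2 * τh s) with hGs
  have hRpos : ∀ s ∈ Set.Icc (0:ℝ) s₁, 0 < R s := fun s hs => Real.sqrt_pos.2 (hrad s hs)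
  have hR2 : ∀ s ∈ Set.Icc (0:ℝ) s₁, R s ^ 2 = 4 - g₂ * s ^ 4 - g₃ * s ^ 6 := fun s hs =>
    Real.sq_sqrt (hrad s hs).le
  have hDlpos : ∀ s ∈ Set.Icc (0:ℝ) s₁, 0 < Dl s := fun s hs => by
    have : 0 ≤ -(y₁ * s ^ 3) := by nlinarith [hs.1, pow_nonneg hs.1 3]
    simp only [hDl]; linarith [hRpos s hs]
  have hy₁' : y₁ ^ 2 = 4 * x₁ ^ 3 - g₂ * x₁ - g₃ := by rw [hy₁, hf]
  -- the chart identity for `τ̂` on `(0, s₁]` (the upper-branch identity with `y₁ ↦ −y₁`)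
  have hinv_ge : ∀ s, 0 < s → s ≤ s₁ → x₁ ≤ (s ^ 2)⁻¹ := by
    intro s hs0 hs
    rw [le_inv_comm₀ hx₁0 (by positivity)]
    calc s ^ 2 ≤ s₁ ^ 2 := pow_le_pow_left₀ hs0.le hs 2
      _ = x₁⁻¹ := eq_inv_of_mul_eq_one_left hs₁x
  have hsqrt_chart : ∀ s, 0 < s → s ≤ s₁ → Real.sqrt (f (s ^ 2)⁻¹) = R s / s ^ 3 := by
    intro s hs0 hs
    rw [hf]; exact cornerUp_sqrt_chart hs0 (hrad s ⟨hs0.le, hs⟩).le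
  have hτh_chart : ∀ s, 0 < s → s ≤ s₁ → τh s = τ (s ^ 2)⁻¹ := by
    intro s hs0 hs
    have hsI : s ∈ Set.Icc (0:ℝ) s₁ := ⟨hs0.le, hs⟩
    have hD : R s + (-y₁) * s ^ 3 ≠ 0 := by
      have := hDlpos s hsI; simp only [hDl] at this; linarith
    have hyn : (-y₁) ^ 2 = 4 * x₁ ^ 3 - g₂ * x₁ - g₃ := by rw [neg_sq]; exact hy₁'
    have key := cornerUp_tau_chart (g₂ := g₂) (g₃ := g₃) (x₁ := x₁) hs0.ne' hD (hR2 s hsI) hyn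
    -- rewrite both sides into our functions
    have lhs : τh s = (32 * x₁ + 4 * (12 * x₁ ^ 2 - g₂) * s ^ 2 - 8 * -y₁ * s * R s +
        (16 * x₁ ^ 3 - 4 * g₂ * x₁ + 8 * g₃) * s ^ 4 + (4 * x₁ ^ 2 - g₂) ^ 2 * s ^ 6) /
        (4 * (R s + -y₁ * s ^ 3) ^ 2) - x₁ := by
      simp only [hτh, hNt, hDl]; ring_nf
    have rhs : τ (s ^ 2)⁻¹ = ((4 * (s ^ 2)⁻¹ ^ 2 + 4 * (s ^ 2)⁻¹ * x₁ + 4 * x₁ ^ 2 - g₂) /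
        (R s / s ^ 3 + -y₁)) ^ 2 / 4 - (s ^ 2)⁻¹ - x₁ := by
      simp only [hτ, hsl, hyb]
      rw [hsqrt_chart s hs0 hs]
      congr 2
      rw [div_pow, div_pow]
      congr 1
      rw [← neg_sq]; ring
    rw [lhs, rhs, key]
  -- positivity of the lower chart data on `[0, s₁]`
  have hR0 : R 0 = 2 := by
    simp only [hR]
    rw [show (4:ℝ) - g₂ * 0 ^ 4 - g₃ * 0 ^ 6 = 2 ^ 2 by norm_num, Real.sqrt_sq (by norm_num)]
  have hτh0 : τh 0 = x₁ := by
    simp only [hτh, hNt, hDl, hR0]; ring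
  have hτhpos : ∀ s ∈ Set.Icc (0:ℝ) s₁, 0 < τh s ∧ 0 < f (τh s) ∧ 0 < τ (τh s) := by
    intro s hs
    rcases hs.1.eq_or_lt with h0 | hs0
    · rw [← h0, hτh0, hτx₁]
      exact ⟨hx₁0, hfpos x₁ hx₁, hx₂0⟩
    · rw [hτh_chart s hs0 hs.2]
      obtain ⟨hlo, hhi⟩ := hτrange _ (hinv_ge s hs0 hs.2)
      refine ⟨hx₂0.trans_le hlo, hfpos _ (he₂.trans_le hlo), ?_⟩
      exact he₁0.trans (hτ12 _ hlo hhi).1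
  -- the landed chart theorem
  obtain ⟨C3, ⟨hcR, hcτh, hcQh, hcGs⟩, ⟨_, hτh0', hQh0, hGs0, _⟩, ⟨hsR, hsτh, hsQh, hsGs⟩⟩ :=
    stub_cornerChartLower g₂ g₃ x₁ y₁ L₁ s₁ f yb sl τ Pg R Mh Dl Nt τh A₁ Qh Kh Gs hf hy₁ hy₁0 hx₁0 hs₁ hs₁x hL₁
      ag₂ ag₃ ax₁ ay₁ hyb hsl hτ hPg rfl rfl rfl rfl rfl rfl rfl rfl rfl hrad hτhpos
  -- agreement of the chart potentials with the x-chart ones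
  have hagree : ∀ s, 0 < s → s ≤ s₁ →
      Real.sqrt (f (s ^ 2)⁻¹) = R s / s ^ 3 ∧ τh s = τ (s ^ 2)⁻¹ ∧ Qh s = Qf (s ^ 2)⁻¹ ∧ Gs s = G (s ^ 2)⁻¹ ∧
        x₁ ≤ (s ^ 2)⁻¹ := by
    intro s hs0 hs
    obtain ⟨h1, h2, _, h4, h5⟩ := C3 s hs0 hs
    have hx := hinv_ge s hs0 hs
    obtain ⟨_, _, hx33, hy3', _⟩ := hpt _ hx
    refine ⟨h1, h2, ?_, ?_, hx⟩
    · rw [h4]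
      have : Y3 (s ^ 2)⁻¹ = -Real.sqrt (f (τ (s ^ 2)⁻¹)) := by rw [hy3']; simp only [hyb]
      simp only [hQf]
      rw [this]; ring
    · rw [h5]
      simp only [hG]
      rw [hx33]
  refine ⟨R, τh, Qh, Gs, hrad, hagree, hRpos, hcR, hsR, hR0, hτh0, hQh0, hGs0, hcτh, hsτh, ?_, ?_, hcQh, hsQh,
    hcGs, ?_, hsGs, hpt⟩
  · -- `τ̂` maps `[0, s₁]` into `[x₂, x₁]`
    intro s hs
    rcases hs.1.eq_or_lt with h0 | hs0
    · rw [← h0, hτh0]; exact ⟨hx₂₁.le, le_rfl⟩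
    · rw [hτh_chart s hs0 hs.2]
      obtain ⟨hlo, hhi⟩ := hτrange _ (hinv_ge s hs0 hs.2)
      exact ⟨hlo, hhi.le⟩
  · intro s hs
    rw [hτh_chart s hs.1 hs.2.le, ← hτimg]
    refine ⟨(s ^ 2)⁻¹, ?_, rfl⟩
    show x₁ < (s ^ 2)⁻¹
    rw [lt_inv_comm₀ hx₁0 (by nlinarith [hs.1])]
    calc s ^ 2 < s₁ ^ 2 := pow_lt_pow_left₀ hs.2 hs.1.le two_ne_zero
      _ = x₁⁻¹ := eq_inv_of_mul_eq_one_left hs₁x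
  · -- `Ĝ ≠ 0` on `[0, s₁]`
    intro s hs
    rcases hs.1.eq_or_lt with h0 | hs0
    · rw [← h0, hGs0, hτx₁]
      have : 0 < Real.sqrt x₂ := Real.sqrt_pos.2 hx₂0
      intro h
      rw [div_eq_zero_iff] at h
      rcases h with h | h
      · nlinarith
      · exact hx₁0.ne' h
    · rw [(hagree s hs0 hs.2).2.2.2.1]
      exact (hpt _ (hinv_ge s hs0 hs.2)).2.2.2.2.2.2.2.1

end Summit.KontsevichZagierPeriods.KontsevichZagierPeriods.Cruxes.NeronTorsionSector.Translation
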